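import Summits.AtomisticToContinuum.FouriersLaw.Theorems.OddSectorIrreversibilitySubBallisticWindowTimeAveragedCorrector
import Mathlib.Analysis.SpecialFunctions.ImproperIntegrals
import Mathlib.MeasureTheory.Integral.ExpDecay

/-!
# `SubBallisticWindow` (stmt-AtomisticToContinuum-14070): the Abel (resolvent) corrector of the closed chain, part 1

Support file for crux `Summit.AtomisticToContinuum.FouriersLaw.Theses.OddSectorIrreversibility.SubBallisticWindow`
(E2 of route OddSectorIrreversibility). For the CLOSED pinned chain (Hamiltonian flow `Φ_t = detFlow`, Gibbs weight
`μ_T = e^{-H/T} dq dp`, block current `J_B = blockCurrent`) and a rate `r > 0`, the ABEL (resolvent) CORRECTOR is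
`u_r(x) = ∫_{(0,∞)} e^{-r t} J_B(Φ_t x) dt` — the Laplace transform of the transported current, i.e. `(r - L)⁻¹ J_B`
for the Liouvillian `L`; it is written out explicitly everywhere (no new definition). This part is the calculus that needs
NO spatial regularity of `u_r` (only the flow property and Liouville invariance):

* §1 (fixed initial point `x`): absolute convergence and the energy bound `|u_r(x)| ≤ K(x)/r`
  (`K(x) = N² (3+β)/2 (1+H(x))²`, energy conservation); the FLOW SHIFT
  `e^{-r s} u_r(Φ_s x) = u_r(x) - ∫₀ˢ e^{-r t} J_B(Φ_t x) dt` (`s ≥ 0`); continuity and the derivative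
  `d/ds u_r(Φ_s x) = r u_r(Φ_s x) - J_B(Φ_s x)` (`s > 0`), i.e. `(r - L) u_r = J_B` along the flow; and the WINDOW IDENTITY
  `∫_{(0,τ]} J_B(Φ_s x) ds = r ∫_{(0,τ]} u_r(Φ_s x) ds - (u_r(Φ_τ x) - u_r(x))`.
* §2 (`L²(μ_T)`): measurability, `u_r ∈ L²(μ_T)`, and the ceiling
  `∫ (∫_{(0,τ]} J_B∘Φ_s ds)² dμ_T ≤ 3 (r² τ² + 2) ∫ u_r² dμ_T` (Minkowski/Jensen in `s`, Tonelli, invariance of `μ_T`).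

Part 2 (`…SubBallisticWindowAbelGreenKubo.lean`) turns the ceiling (at `r = 1/τ`) into
`(N-uniform bound r ∫ u_r² dμ_T ≤ C ℓ Z, r ∈ (0,1]) → SubBallisticWindow` and proves the converse. Nothing here
closes the item. Lead c8 of line `Sketch`, 2026-08-17.
-/

noncomputable section

namespace Summit.AtomisticToContinuum.FouriersLaw.Theorems.SubBallisticWindow.AbelGreenKubo

open MeasureTheory Filter Topology Set
open scoped NNReal ENNReal
open Literature.MathematicalPhysics.KineticTheory.HeatConduction
open Summit.AtomisticToContinuum.FouriersLaw.Theorems.ClosedConeSensitivity.Negative.ZeroFrictionDictionary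
open Summit.AtomisticToContinuum.FouriersLaw.Theorems.OddSectorWitness

variable {ω₂ lam β : ℝ} (hω : 0 < ω₂) (hl : 0 ≤ lam) (hβ : 0 ≤ β)
include hω hl hβ

/-! ## §1 The Abel integral at a fixed initial point -/

section Pointwise

variable (γ : ℝ) (N k₁ k₂ : ℕ)

/-- The Abel integrand `t ↦ e^{-r t} J_B(Φ_t x)` is continuous in `t`. [folklore] -/
theorem continuous_abelIntegrand (r : ℝ) (x : PhaseSpace N) :
    Continuous fun t : ℝ => Real.exp (-r * t) * blockCurrent ω₂ lam β γ N k₁ k₂ (detFlow ω₂ lam β N t x) :=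
  (Real.continuous_exp.comp (continuous_const.mul continuous_id)).mul
    ((continuous_blockCurrent N γ k₁ k₂).comp (continuous_detFlow_time hω hl hβ N x))

/-- Energy domination of the Abel integrand: `|e^{-r t} J_B(Φ_t x)| ≤ K(x) e^{-r t}` with
`K(x) = N² (3+β)/2 (1+H(x))²`. [folklore] -/
theorem norm_abelIntegrand_le (r t : ℝ) (x : PhaseSpace N) :
    ‖Real.exp (-r * t) * blockCurrent ω₂ lam β γ N k₁ k₂ (detFlow ω₂ lam β N t x)‖ ≤
      (N * (N * ((3 + β) / 2 * (1 + (pinnedChain ω₂ lam β γ).hamiltonian N x) ^ 2))) * Real.exp (-r * t) := by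
  rw [norm_mul, Real.norm_eq_abs, Real.norm_eq_abs, abs_of_pos (Real.exp_pos _), mul_comm]
  exact mul_le_mul_of_nonneg_right (abs_blockCurrent_detFlow_le hω hl hβ N γ k₁ k₂ t x) (Real.exp_pos _).le

/-- The Abel integrand is integrable on every ray `(a, ∞)` (`r > 0`). [folklore] -/
theorem integrableOn_abelIntegrand {r : ℝ} (hr : 0 < r) (x : PhaseSpace N) (a : ℝ) :
    IntegrableOn (fun t : ℝ => Real.exp (-r * t) * blockCurrent ω₂ lam β γ N k₁ k₂ (detFlow ω₂ lam β N t x))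
      (Ioi a) := by
  have hdom : IntegrableOn (fun t : ℝ =>
      (N * (N * ((3 + β) / 2 * (1 + (pinnedChain ω₂ lam β γ).hamiltonian N x) ^ 2))) * Real.exp (-r * t))
      (Ioi a) :=
    (exp_neg_integrableOn_Ioi a hr).const_mul _
  exact hdom.mono' (continuous_abelIntegrand hω hl hβ γ N k₁ k₂ r x).aestronglyMeasurable
    (ae_of_all _ fun t => norm_abelIntegrand_le hω hl hβ γ N k₁ k₂ r t x)

/-- Energy bound for the Abel corrector: `|u_r(x)| ≤ K(x) / r` (`r > 0`). [folklore] -/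
theorem abs_abel_le {r : ℝ} (hr : 0 < r) (x : PhaseSpace N) :
    |∫ t in Ioi (0:ℝ), Real.exp (-r * t) * blockCurrent ω₂ lam β γ N k₁ k₂ (detFlow ω₂ lam β N t x)| ≤
      (N * (N * ((3 + β) / 2 * (1 + (pinnedChain ω₂ lam β γ).hamiltonian N x) ^ 2))) / r := by
  set K := (N * (N * ((3 + β) / 2 * (1 + (pinnedChain ω₂ lam β γ).hamiltonian N x) ^ 2)) : ℝ) with hK
  have hdom : IntegrableOn (fun t : ℝ => K * Real.exp (-r * t)) (Ioi (0:ℝ)) :=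
    (exp_neg_integrableOn_Ioi 0 hr).const_mul _
  have h := norm_integral_le_of_norm_le hdom
    (ae_of_all _ fun t => norm_abelIntegrand_le hω hl hβ γ N k₁ k₂ r t x)
  rw [Real.norm_eq_abs] at h
  refine h.trans (le_of_eq ?_)
  rw [integral_const_mul, integral_exp_mul_Ioi (neg_neg_iff_pos.2 hr) 0]
  field_simp
  simp

/-- **Flow shift.** For `s ≥ 0`: `e^{-r s} u_r(Φ_s x) = u_r(x) - ∫₀ˢ e^{-r t} J_B(Φ_t x) dt` (flow property
`Φ_t ∘ Φ_s = Φ_{s+t}` and the translation `t ↦ t + s`). [folklore] -/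
theorem exp_mul_abel_comp_detFlow {r : ℝ} (hr : 0 < r) (x : PhaseSpace N) {s : ℝ} (hs : 0 ≤ s) :
    Real.exp (-r * s) * ∫ t in Ioi (0:ℝ), Real.exp (-r * t) *
        blockCurrent ω₂ lam β γ N k₁ k₂ (detFlow ω₂ lam β N t (detFlow ω₂ lam β N s x)) =
      (∫ t in Ioi (0:ℝ), Real.exp (-r * t) * blockCurrent ω₂ lam β γ N k₁ k₂ (detFlow ω₂ lam β N t x)) -
        ∫ t in (0:ℝ)..s, Real.exp (-r * t) * blockCurrent ω₂ lam β γ N k₁ k₂ (detFlow ω₂ lam β N t x) := by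
  set g : ℝ → ℝ := fun t => Real.exp (-r * t) * blockCurrent ω₂ lam β γ N k₁ k₂ (detFlow ω₂ lam β N t x) with hg
  -- flow property inside the integral, then absorb `e^{-rs}`
  have h1 : Real.exp (-r * s) * ∫ t in Ioi (0:ℝ), Real.exp (-r * t) *
      blockCurrent ω₂ lam β γ N k₁ k₂ (detFlow ω₂ lam β N t (detFlow ω₂ lam β N s x)) =
      ∫ t in Ioi (0:ℝ), g (t + s) := by
    rw [← integral_const_mul]
    refine setIntegral_congr_fun measurableSet_Ioi fun t ht => ?_
    simp only [hg]
    rw [← Summit.AtomisticToContinuum.FouriersLaw.Theorems.OddSectorIrreversibility.Corrector.detFlow_add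
      hω hl hβ N x hs (le_of_lt ht), add_comm s t, ← mul_assoc, ← Real.exp_add]
    congr 2
    ring
  -- translation `t ↦ t + s`
  have h2 : ∫ t in Ioi (0:ℝ), g (t + s) = ∫ t in Ioi s, g t := by
    have hmp : MeasurePreserving (fun t : ℝ => t + s) volume volume := measurePreserving_add_right volume s
    have hme : MeasurableEmbedding fun t : ℝ => t + s := (MeasurableEquiv.addRight s).measurableEmbedding
    have h := hmp.setIntegral_preimage_emb hme g (Ioi s)
    rw [preimage_add_const_Ioi, sub_self] at h
    exact h
  -- split `(0, ∞) = (0, s] ∪ (s, ∞)`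
  have hIoi : IntegrableOn g (Ioi (0:ℝ)) := integrableOn_abelIntegrand hω hl hβ γ N k₁ k₂ hr x 0
  have h3 : ∫ t in Ioi (0:ℝ), g t = (∫ t in Ioc (0:ℝ) s, g t) + ∫ t in Ioi s, g t := by
    rw [← setIntegral_union (Ioc_disjoint_Ioi le_rfl) measurableSet_Ioi
      (hIoi.mono_set Ioc_subset_Ioi_self) (hIoi.mono_set (Ioi_subset_Ioi hs)), Ioc_union_Ioi_eq_Ioi hs]
  rw [h1, h2, h3, intervalIntegral.integral_of_le hs]
  ring

/-- The flow shift solved for the transported corrector: for `s ≥ 0`,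
`u_r(Φ_s x) = e^{r s} (u_r(x) - ∫₀ˢ e^{-r t} J_B(Φ_t x) dt)`. [folklore] -/
theorem abel_comp_detFlow_eq {r : ℝ} (hr : 0 < r) (x : PhaseSpace N) {s : ℝ} (hs : 0 ≤ s) :
    (∫ t in Ioi (0:ℝ), Real.exp (-r * t) *
        blockCurrent ω₂ lam β γ N k₁ k₂ (detFlow ω₂ lam β N t (detFlow ω₂ lam β N s x))) =
      Real.exp (r * s) *
        ((∫ t in Ioi (0:ℝ), Real.exp (-r * t) * blockCurrent ω₂ lam β γ N k₁ k₂ (detFlow ω₂ lam β N t x)) -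
          ∫ t in (0:ℝ)..s, Real.exp (-r * t) * blockCurrent ω₂ lam β γ N k₁ k₂ (detFlow ω₂ lam β N t x)) := by
  rw [← exp_mul_abel_comp_detFlow hω hl hβ γ N k₁ k₂ hr x hs, ← mul_assoc, ← Real.exp_add,
    show r * s + -r * s = 0 by ring, Real.exp_zero, one_mul]

/-- The transported corrector `s ↦ u_r(Φ_s x)` agrees, for ALL `s`, with the continuous expression
`s ↦ e^{r s⁺} (u_r(x) - ∫₀^{s⁺} e^{-r t} J_B(Φ_t x) dt)` (`s⁺ = max s 0`; the flow is the identity for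
`s ≤ 0`). [folklore] -/
theorem abel_comp_detFlow_eq_max {r : ℝ} (hr : 0 < r) (x : PhaseSpace N) (s : ℝ) :
    (∫ t in Ioi (0:ℝ), Real.exp (-r * t) *
        blockCurrent ω₂ lam β γ N k₁ k₂ (detFlow ω₂ lam β N t (detFlow ω₂ lam β N s x))) =
      Real.exp (r * max s 0) *
        ((∫ t in Ioi (0:ℝ), Real.exp (-r * t) * blockCurrent ω₂ lam β γ N k₁ k₂ (detFlow ω₂ lam β N t x)) -
          ∫ t in (0:ℝ)..max s 0, Real.exp (-r * t) * blockCurrent ω₂ lam β γ N k₁ k₂ (detFlow ω₂ lam β N t x)) := by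
  rcases le_or_gt s 0 with hs | hs
  · rw [max_eq_right hs, detFlow_of_nonpos N hs, mul_zero, Real.exp_zero, one_mul,
      intervalIntegral.integral_same, sub_zero]
  · rw [max_eq_left hs.le]
    exact abel_comp_detFlow_eq hω hl hβ γ N k₁ k₂ hr x hs.le

/-- The transported corrector `s ↦ u_r(Φ_s x)` is continuous on `ℝ`. [folklore] -/
theorem continuous_abel_comp_detFlow {r : ℝ} (hr : 0 < r) (x : PhaseSpace N) :
    Continuous fun s : ℝ => ∫ t in Ioi (0:ℝ), Real.exp (-r * t) *
        blockCurrent ω₂ lam β γ N k₁ k₂ (detFlow ω₂ lam β N t (detFlow ω₂ lam β N s x)) := by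
  have hg := continuous_abelIntegrand hω hl hβ γ N k₁ k₂ r x
  have hprim : Continuous fun u : ℝ => ∫ t in (0:ℝ)..u, Real.exp (-r * t) *
      blockCurrent ω₂ lam β γ N k₁ k₂ (detFlow ω₂ lam β N t x) :=
    intervalIntegral.continuous_primitive (fun _ _ => hg.intervalIntegrable _ _) 0
  have hE : Continuous fun u : ℝ => Real.exp (r * u) *
      ((∫ t in Ioi (0:ℝ), Real.exp (-r * t) * blockCurrent ω₂ lam β γ N k₁ k₂ (detFlow ω₂ lam β N t x)) -
        ∫ t in (0:ℝ)..u, Real.exp (-r * t) * blockCurrent ω₂ lam β γ N k₁ k₂ (detFlow ω₂ lam β N t x)) :=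
    (Real.continuous_exp.comp (continuous_const.mul continuous_id)).mul (continuous_const.sub hprim)
  have heq := funext (abel_comp_detFlow_eq_max hω hl hβ γ N k₁ k₂ hr x)
  rw [heq]
  exact hE.comp (continuous_id.max continuous_const)

/-- **`(r - L) u_r = J_B` along the flow**: for `s > 0`,
`d/ds u_r(Φ_s x) = r u_r(Φ_s x) - J_B(Φ_s x)`. [folklore] -/
theorem hasDerivAt_abel_comp_detFlow {r : ℝ} (hr : 0 < r) (x : PhaseSpace N) {s : ℝ} (hs : 0 < s) :
    HasDerivAt (fun s : ℝ => ∫ t in Ioi (0:ℝ), Real.exp (-r * t) *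
        blockCurrent ω₂ lam β γ N k₁ k₂ (detFlow ω₂ lam β N t (detFlow ω₂ lam β N s x)))
      (r * (∫ t in Ioi (0:ℝ), Real.exp (-r * t) *
          blockCurrent ω₂ lam β γ N k₁ k₂ (detFlow ω₂ lam β N t (detFlow ω₂ lam β N s x))) -
        blockCurrent ω₂ lam β γ N k₁ k₂ (detFlow ω₂ lam β N s x)) s := by
  set u0 : ℝ := ∫ t in Ioi (0:ℝ), Real.exp (-r * t) * blockCurrent ω₂ lam β γ N k₁ k₂ (detFlow ω₂ lam β N t x)
    with hu0
  set g : ℝ → ℝ := fun t => Real.exp (-r * t) * blockCurrent ω₂ lam β γ N k₁ k₂ (detFlow ω₂ lam β N t x) with hg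
  have hgc : Continuous g := continuous_abelIntegrand hω hl hβ γ N k₁ k₂ r x
  -- derivative of the explicit expression `E(s) = e^{rs} (u0 - ∫₀ˢ g)`
  have hI : HasDerivAt (fun u : ℝ => ∫ t in (0:ℝ)..u, g t) (g s) s :=
    TimeAveragedCorrector.hasDerivAt_primitive hgc 0 s
  have hexp : HasDerivAt (fun u : ℝ => Real.exp (r * u)) (Real.exp (r * s) * r) s := by
    have h := ((hasDerivAt_id s).const_mul r).exp
    simpa using h
  have hE : HasDerivAt (fun u : ℝ => Real.exp (r * u) * (u0 - ∫ t in (0:ℝ)..u, g t))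
      (Real.exp (r * s) * r * (u0 - ∫ t in (0:ℝ)..s, g t) + Real.exp (r * s) * (0 - g s)) s :=
    hexp.mul ((hasDerivAt_const s u0).sub hI)
  -- the transported corrector agrees with `E` near `s > 0`
  have hev : (fun s : ℝ => ∫ t in Ioi (0:ℝ), Real.exp (-r * t) *
      blockCurrent ω₂ lam β γ N k₁ k₂ (detFlow ω₂ lam β N t (detFlow ω₂ lam β N s x))) =ᶠ[𝓝 s]
      fun u : ℝ => Real.exp (r * u) * (u0 - ∫ t in (0:ℝ)..u, g t) := by
    filter_upwards [Ioi_mem_nhds hs] with u hu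
    exact abel_comp_detFlow_eq hω hl hβ γ N k₁ k₂ hr x (le_of_lt hu)
  refine (hE.congr_of_eventuallyEq hev).congr_deriv ?_
  rw [abel_comp_detFlow_eq hω hl hβ γ N k₁ k₂ hr x hs.le]
  have hgs : g s = Real.exp (-r * s) * blockCurrent ω₂ lam β γ N k₁ k₂ (detFlow ω₂ lam β N s x) := rfl
  rw [hgs, zero_sub, mul_neg, ← mul_assoc, ← Real.exp_add, show r * s + -r * s = 0 by ring, Real.exp_zero,
    one_mul]
  ring

/-- **Window identity.** For `τ ≥ 0` and `r > 0`:
`∫_{(0,τ]} J_B(Φ_s x) ds = r ∫_{(0,τ]} u_r(Φ_s x) ds - (u_r(Φ_τ x) - u_r(x))` (FTC for `s ↦ u_r(Φ_s x)`). [folklore] -/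
theorem window_eq_abel {r : ℝ} (hr : 0 < r) (x : PhaseSpace N) {τ : ℝ} (hτ : 0 ≤ τ) :
    window ω₂ lam β γ N k₁ k₂ τ x =
      r * (∫ s in Ioc (0:ℝ) τ, ∫ t in Ioi (0:ℝ), Real.exp (-r * t) *
          blockCurrent ω₂ lam β γ N k₁ k₂ (detFlow ω₂ lam β N t (detFlow ω₂ lam β N s x))) -
        ((∫ t in Ioi (0:ℝ), Real.exp (-r * t) *
            blockCurrent ω₂ lam β γ N k₁ k₂ (detFlow ω₂ lam β N t (detFlow ω₂ lam β N τ x))) -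
          ∫ t in Ioi (0:ℝ), Real.exp (-r * t) * blockCurrent ω₂ lam β γ N k₁ k₂ (detFlow ω₂ lam β N t x)) := by
  set U : ℝ → ℝ := fun s => ∫ t in Ioi (0:ℝ), Real.exp (-r * t) *
      blockCurrent ω₂ lam β γ N k₁ k₂ (detFlow ω₂ lam β N t (detFlow ω₂ lam β N s x)) with hU
  set j : ℝ → ℝ := fun s => blockCurrent ω₂ lam β γ N k₁ k₂ (detFlow ω₂ lam β N s x) with hj
  have hUc : Continuous U := continuous_abel_comp_detFlow hω hl hβ γ N k₁ k₂ hr x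
  have hjc : Continuous j := (continuous_blockCurrent N γ k₁ k₂).comp (continuous_detFlow_time hω hl hβ N x)
  -- FTC on `[0, τ]` with the right derivative on `(0, τ)`
  have hc2 : Continuous fun s => r * U s - j s := (hUc.const_mul r).sub hjc
  have hftc : ∫ s in (0:ℝ)..τ, (r * U s - j s) = U τ - U 0 :=
    intervalIntegral.integral_eq_sub_of_hasDeriv_right_of_le hτ hUc.continuousOn
      (fun s hs => (hasDerivAt_abel_comp_detFlow hω hl hβ γ N k₁ k₂ hr x hs.1).hasDerivWithinAt)
      (hc2.intervalIntegrable 0 τ)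
  have hU0 : U 0 = ∫ t in Ioi (0:ℝ), Real.exp (-r * t) * blockCurrent ω₂ lam β γ N k₁ k₂ (detFlow ω₂ lam β N t x) := by
    simp only [hU, detFlow_of_nonpos N le_rfl]
  rw [intervalIntegral.integral_sub ((hUc.const_mul r).intervalIntegrable _ _) (hjc.intervalIntegrable _ _),
    intervalIntegral.integral_const_mul, intervalIntegral.integral_of_le hτ,
    intervalIntegral.integral_of_le hτ] at hftc
  unfold window
  rw [← hU0]
  simp only [hj] at hftc
  linarith

end Pointwise

/-! ## §2 The Abel corrector in `L²(μ_T)` and the window ceiling -/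

section L2

variable (γ : ℝ) (N k₁ k₂ : ℕ)

/-- The Abel corrector `x ↦ u_r(x)` is measurable (Fubini measurability of a jointly measurable integrand). [folklore] -/
theorem measurable_abel (r : ℝ) :
    Measurable fun x : PhaseSpace N => ∫ t in Ioi (0:ℝ), Real.exp (-r * t) *
      blockCurrent ω₂ lam β γ N k₁ k₂ (detFlow ω₂ lam β N t x) := by
  -- (elaborate the swapped current FORWARD: an expected type on `.comp measurable_swap` sends the unifier
  -- into unfolding `detFlow`)
  have hJ : StronglyMeasurable fun p : PhaseSpace N × ℝ =>
      blockCurrent ω₂ lam β γ N k₁ k₂ (detFlow ω₂ lam β N p.2 p.1) :=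
    ((measurable_blockCurrent_detFlow hω hl hβ N γ k₁ k₂).comp measurable_swap).stronglyMeasurable
  have hE : Continuous fun p : PhaseSpace N × ℝ => Real.exp (-r * p.2) :=
    Real.continuous_exp.comp (continuous_const.mul continuous_snd)
  have hF : StronglyMeasurable fun p : PhaseSpace N × ℝ =>
      Real.exp (-r * p.2) * blockCurrent ω₂ lam β γ N k₁ k₂ (detFlow ω₂ lam β N p.2 p.1) :=
    hE.stronglyMeasurable.mul hJ
  exact (hF.integral_prod_right' (ν := volume.restrict (Ioi (0 : ℝ)))).measurable

/-- `u_r ∈ L²(μ_T)` (`r > 0`, `T > 0`): the energy bound `|u_r| ≤ K/r` and Gaussian confinement. [folklore] -/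
theorem memLp_two_abel {T : ℝ} (hT : 0 < T) {r : ℝ} (hr : 0 < r) :
    MemLp (fun x : PhaseSpace N => ∫ t in Ioi (0:ℝ), Real.exp (-r * t) *
      blockCurrent ω₂ lam β γ N k₁ k₂ (detFlow ω₂ lam β N t x)) 2 (gibbsWeight ω₂ lam β γ N T) := by
  refine memLp_two_of_abs_le_pow hω hl hβ γ N hT
    (measurable_abel hω hl hβ γ N k₁ k₂ r).aestronglyMeasurable (N * (N * ((3 + β) / 2)) / r) 2 fun x => ?_
  refine (abs_abel_le hω hl hβ γ N k₁ k₂ hr x).trans (le_of_eq ?_)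
  ring

/-- `u_r²` is `μ_T`-integrable. [folklore] -/
theorem integrable_sq_abel {T : ℝ} (hT : 0 < T) {r : ℝ} (hr : 0 < r) :
    Integrable (fun x : PhaseSpace N => (∫ t in Ioi (0:ℝ), Real.exp (-r * t) *
      blockCurrent ω₂ lam β γ N k₁ k₂ (detFlow ω₂ lam β N t x)) ^ 2) (gibbsWeight ω₂ lam β γ N T) :=
  (memLp_two_iff_integrable_sq (measurable_abel hω hl hβ γ N k₁ k₂ r).aestronglyMeasurable).1
    (memLp_two_abel hω hl hβ γ N k₁ k₂ hT hr)

omit hω hl hβ in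
/-- Tonelli + Liouville for a MEASURABLE `R ∈ L²(μ_T)` (the continuity assumed in
`CoboundaryCeiling.integral_setIntegral_sq_comp_detFlow` is only used for measurability): for `τ ≥ 0`,
`x ↦ ∫_{(0,τ]} R(Φ_t x)² dt` is `μ_T`-integrable and `∫ ∫_{(0,τ]} R(Φ_t x)² dt dμ_T = τ ∫ R² dμ_T`. [folklore] -/
theorem integral_setIntegral_sq_comp_detFlow_of_measurable (hω : 0 < ω₂) (hl : 0 ≤ lam) (hβ : 0 ≤ β)
    (γ : ℝ) (N : ℕ) {T : ℝ} (hT : 0 < T) {τ : ℝ} (hτ : 0 ≤ τ)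
    {R : PhaseSpace N → ℝ} (hRm : Measurable R) (hR : MemLp R 2 (gibbsWeight ω₂ lam β γ N T)) :
    Integrable (fun x => ∫ t in Ioc (0 : ℝ) τ, (R (detFlow ω₂ lam β N t x)) ^ 2) (gibbsWeight ω₂ lam β γ N T) ∧
    ∫ x, (∫ t in Ioc (0 : ℝ) τ, (R (detFlow ω₂ lam β N t x)) ^ 2) ∂(gibbsWeight ω₂ lam β γ N T) =
      τ * ∫ x, (R x) ^ 2 ∂(gibbsWeight ω₂ lam β γ N T) := by
  -- adapted from `CoboundaryCeiling.integral_setIntegral_sq_comp_detFlow` (continuity ↦ measurability)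
  haveI := isFiniteMeasure_gibbsWeight hω hl hβ γ N hT
  have hR2 : Integrable (fun x => (R x) ^ 2) (gibbsWeight ω₂ lam β γ N T) :=
    (memLp_two_iff_integrable_sq hR.1).1 hR
  have hFm : Measurable fun p : ℝ × PhaseSpace N => (R (detFlow ω₂ lam β N p.1 p.2)) ^ 2 :=
    (hRm.comp (measurable_detFlow_uncurry hω hl hβ N)).pow_const 2
  have hslice : ∀ t : ℝ, 0 ≤ t →
      Integrable (fun x => (R (detFlow ω₂ lam β N t x)) ^ 2) (gibbsWeight ω₂ lam β γ N T) ∧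
      ∫ x, (R (detFlow ω₂ lam β N t x)) ^ 2 ∂(gibbsWeight ω₂ lam β γ N T) =
        ∫ x, (R x) ^ 2 ∂(gibbsWeight ω₂ lam β γ N T) := fun t ht =>
    ⟨CoboundaryCeiling.integrable_comp_detFlow_gibbsWeight hω hl hβ γ N T ht (g := fun x => (R x) ^ 2) hR2,
      CoboundaryCeiling.integral_comp_detFlow_gibbsWeight hω hl hβ γ N T ht (g := fun x => (R x) ^ 2)
        hR2.aestronglyMeasurable⟩
  have hInt : Integrable (fun p : ℝ × PhaseSpace N => (R (detFlow ω₂ lam β N p.1 p.2)) ^ 2)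
      ((volume.restrict (Ioc (0 : ℝ) τ)).prod (gibbsWeight ω₂ lam β γ N T)) := by
    rw [integrable_prod_iff hFm.aestronglyMeasurable]
    refine ⟨(ae_restrict_iff' measurableSet_Ioc).2 (Eventually.of_forall fun t ht => (hslice t ht.1.le).1), ?_⟩
    have hae : (fun t => ∫ x, ‖(R (detFlow ω₂ lam β N t x)) ^ 2‖ ∂(gibbsWeight ω₂ lam β γ N T))
        =ᵐ[volume.restrict (Ioc (0 : ℝ) τ)] fun _ => ∫ x, (R x) ^ 2 ∂(gibbsWeight ω₂ lam β γ N T) := by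
      refine (ae_restrict_iff' measurableSet_Ioc).2 (Eventually.of_forall fun t ht => ?_)
      rw [← (hslice t ht.1.le).2]
      refine integral_congr_ae (Eventually.of_forall fun x => ?_)
      simp only [Real.norm_eq_abs, abs_pow, sq_abs]
    exact (integrable_const _).congr hae.symm
  refine ⟨hInt.integral_prod_right, ?_⟩
  rw [← integral_integral_swap (f := fun t x => (R (detFlow ω₂ lam β N t x)) ^ 2) hInt,
    setIntegral_congr_fun measurableSet_Ioc (fun t ht => (hslice t ht.1.le).2), setIntegral_const,
    Real.volume_real_Ioc_of_le hτ, sub_zero, smul_eq_mul]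

omit hω hl hβ in
/-- Elementary: `(a - (b - c))² ≤ 3 (a² + b² + c²)`. [folklore] -/
theorem sq_sub_sub_le (a b c : ℝ) : (a - (b - c)) ^ 2 ≤ 3 * (a ^ 2 + b ^ 2 + c ^ 2) := by
  nlinarith [sq_nonneg (a + b), sq_nonneg (a - c), sq_nonneg (b + c)]

/-- **The Abel window ceiling.** For `τ ≥ 0`, `r > 0`, `T > 0`:
`∫ (∫_{(0,τ]} J_B(Φ_s x) ds)² dμ_T ≤ 3 (r² τ² + 2) ∫ u_r² dμ_T`
(window identity, `(a-(b-c))² ≤ 3(a²+b²+c²)`, Cauchy–Schwarz in `s`, Tonelli, invariance of `μ_T`). No regularity of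
`u_r` in `x` beyond measurability is used. [folklore] -/
theorem integral_window_sq_le_abel {T : ℝ} (hT : 0 < T) {r : ℝ} (hr : 0 < r) {τ : ℝ} (hτ : 0 ≤ τ) :
    ∫ x, (window ω₂ lam β γ N k₁ k₂ τ x) ^ 2 ∂(gibbsWeight ω₂ lam β γ N T) ≤
      3 * (r ^ 2 * τ ^ 2 + 2) * ∫ x, (∫ t in Ioi (0:ℝ), Real.exp (-r * t) *
        blockCurrent ω₂ lam β γ N k₁ k₂ (detFlow ω₂ lam β N t x)) ^ 2 ∂(gibbsWeight ω₂ lam β γ N T) := by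
  haveI := isFiniteMeasure_gibbsWeight hω hl hβ γ N hT
  set μ := gibbsWeight ω₂ lam β γ N T with hμ
  set u : PhaseSpace N → ℝ := fun x => ∫ t in Ioi (0:ℝ), Real.exp (-r * t) *
      blockCurrent ω₂ lam β γ N k₁ k₂ (detFlow ω₂ lam β N t x) with hu
  have hum : Measurable u := measurable_abel hω hl hβ γ N k₁ k₂ r
  have huL : MemLp u 2 μ := memLp_two_abel hω hl hβ γ N k₁ k₂ hT hr
  have hu2 : Integrable (fun x => (u x) ^ 2) μ := integrable_sq_abel hω hl hβ γ N k₁ k₂ hT hr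
  -- the three pieces of the window identity
  have hA := integral_setIntegral_sq_comp_detFlow_of_measurable hω hl hβ γ N hT hτ hum huL
  have hB : Integrable (fun x => (u (detFlow ω₂ lam β N τ x)) ^ 2) μ :=
    CoboundaryCeiling.integrable_comp_detFlow_gibbsWeight hω hl hβ γ N T hτ (g := fun x => (u x) ^ 2) hu2
  have hBint : ∫ x, (u (detFlow ω₂ lam β N τ x)) ^ 2 ∂μ = ∫ x, (u x) ^ 2 ∂μ :=
    CoboundaryCeiling.integral_comp_detFlow_gibbsWeight hω hl hβ γ N T hτ (g := fun x => (u x) ^ 2)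
      hu2.aestronglyMeasurable
  -- pointwise: window identity, the elementary square bound, Cauchy–Schwarz in `s`
  have hpt : ∀ x, (window ω₂ lam β γ N k₁ k₂ τ x) ^ 2 ≤
      3 * (r ^ 2 * (τ * ∫ s in Ioc (0:ℝ) τ, (u (detFlow ω₂ lam β N s x)) ^ 2) +
        (u (detFlow ω₂ lam β N τ x)) ^ 2 + (u x) ^ 2) := fun x => by
    have hid := window_eq_abel hω hl hβ γ N k₁ k₂ hr x hτ
    have hcs : (∫ s in Ioc (0:ℝ) τ, u (detFlow ω₂ lam β N s x)) ^ 2 ≤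
        τ * ∫ s in Ioc (0:ℝ) τ, (u (detFlow ω₂ lam β N s x)) ^ 2 :=
      CoboundaryCeiling.sq_setIntegral_Ioc_le hτ (continuous_abel_comp_detFlow hω hl hβ γ N k₁ k₂ hr x)
    rw [hid]
    refine (sq_sub_sub_le _ _ _).trans ?_
    have h3 : (r * ∫ s in Ioc (0:ℝ) τ, u (detFlow ω₂ lam β N s x)) ^ 2 ≤
        r ^ 2 * (τ * ∫ s in Ioc (0:ℝ) τ, (u (detFlow ω₂ lam β N s x)) ^ 2) := by
      rw [mul_pow]
      exact mul_le_mul_of_nonneg_left hcs (sq_nonneg r)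
    linarith
  have hI1 : Integrable (fun x => r ^ 2 * (τ * ∫ s in Ioc (0:ℝ) τ, (u (detFlow ω₂ lam β N s x)) ^ 2)) μ :=
    (hA.1.const_mul τ).const_mul (r ^ 2)
  have hI12 : Integrable (fun x => r ^ 2 * (τ * ∫ s in Ioc (0:ℝ) τ, (u (detFlow ω₂ lam β N s x)) ^ 2) +
      (u (detFlow ω₂ lam β N τ x)) ^ 2) μ := hI1.add hB
  have hI123 : Integrable (fun x => r ^ 2 * (τ * ∫ s in Ioc (0:ℝ) τ, (u (detFlow ω₂ lam β N s x)) ^ 2) +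
      (u (detFlow ω₂ lam β N τ x)) ^ 2 + (u x) ^ 2) μ := hI12.add hu2
  have hRHS : Integrable (fun x => 3 * (r ^ 2 * (τ * ∫ s in Ioc (0:ℝ) τ, (u (detFlow ω₂ lam β N s x)) ^ 2) +
      (u (detFlow ω₂ lam β N τ x)) ^ 2 + (u x) ^ 2)) μ := hI123.const_mul 3
  have hmono := integral_mono_of_nonneg (Eventually.of_forall fun x => sq_nonneg _) hRHS
    (Eventually.of_forall hpt)
  refine hmono.trans (le_of_eq ?_)
  have hsplit : ∫ x, 3 * (r ^ 2 * (τ * ∫ s in Ioc (0:ℝ) τ, (u (detFlow ω₂ lam β N s x)) ^ 2) +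
      (u (detFlow ω₂ lam β N τ x)) ^ 2 + (u x) ^ 2) ∂μ =
      3 * (r ^ 2 * (τ * ∫ x, (∫ s in Ioc (0:ℝ) τ, (u (detFlow ω₂ lam β N s x)) ^ 2) ∂μ) +
        ∫ x, (u (detFlow ω₂ lam β N τ x)) ^ 2 ∂μ + ∫ x, (u x) ^ 2 ∂μ) := by
    rw [integral_const_mul, integral_add hI12 hu2, integral_add hI1 hB, integral_const_mul, integral_const_mul]
  rw [hsplit, hA.2, hBint]
  ring

end L2

/-! ## Registered form (crux vocabulary) -/

omit hω hl hβ in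
/-- **abelWindowCeiling** (registered sub-goal of crux `SubBallisticWindow`, crux vocabulary): for the closed pinned
chain, every `N`, block `[k₁,k₂)`, rate `r > 0` and window `τ ≥ 0`,
`∫ (∫_{(0,τ]} J_B(Φ_s x) ds)² dμ_T ≤ 3 (r² τ² + 2) ∫ (∫_{(0,∞)} e^{-rt} J_B(Φ_t x) dt)² dμ_T`
— the windowed block transport is controlled by the `L²(μ_T)` norm of the Abel (resolvent) corrector, with no
regularity of the corrector (`integral_window_sq_le_abel`). [folklore] -/
theorem abelWindowCeiling : ∀ ω₂ lam β γ : ℝ, 0 < ω₂ → 0 ≤ lam → 0 ≤ β → ∀ T : ℝ, 0 < T → ∀ (N k₁ k₂ : ℕ) (r τ : ℝ), 0 < r → 0 ≤ τ → ∫ x, (∫ s in Set.Ioc (0 : ℝ) τ, (∑ i : Fin N, (if k₁ ≤ i.val ∧ i.val < k₂ then (pinnedChain ω₂ lam β γ).bondCurrent N i (detFlow ω₂ lam β N s x) else 0))) ^ 2 ∂(volume.withDensity fun x : PhaseSpace N => ENNReal.ofReal (Real.exp (-((pinnedChain ω₂ lam β γ).hamiltonian N x) / T))) ≤ 3 * (r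 ^ 2 * τ ^ 2 + 2) * ∫ x, (∫ t in Set.Ioi (0 : ℝ), Real.exp (-r * t) * (∑ i : Fin N, (if k₁ ≤ i.val ∧ i.val < k₂ then (pinnedChain ω₂ lam β γ).bondCurrent N i (detFlow ω₂ lam β N t x) else 0))) ^ 2 ∂(volume.withDensity fun x : PhaseSpace N => ENNReal.ofReal (Real.exp (-((pinnedChain ω₂ lam β γ).hamiltonian N x) / T))) := by
  intro ω₂ lam β γ hω hl hβ T hT N k₁ k₂ r τ hr hτ
  have h := integral_window_sq_le_abel hω hl hβ γ N k₁ k₂ hT hr hτ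
  simp only [window, blockCurrent] at h
  exact h

end Summit.AtomisticToContinuum.FouriersLaw.Theorems.SubBallisticWindow.AbelGreenKubo

end
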